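import Literature.AlgebraicGeometry.Motives.TannakianDeligneTorusMumfordTateMorphisms
import Literature.AlgebraicGeometry.Motives.TannakianDeligneTorusMumfordTateCommutant
import HarnessLib

/-!
# MOONEN 1999 (1.13) ∕ (1.21) and (1.14) for morphisms: `Hom_HS(V, V′)` is cut out by the HODGE GROUP of `V ⊕ V′`
# (`Hg(H ⊕ H′) ⊂ C(σ) ⟺ MT(H ⊕ H′) ⊂ C(σ) ⟺ σ` is a morphism), its points intertwine `σ`, and the EXTENDED
# Mumford–Tate group commutes with the endomorphisms of the Hodge structure: `M̃T(H) ⊂ C(f) × 𝔾_m ⟺ f ∈ End_HS(V)`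

[topic AlgebraicGeometry/Motives]

Layer `Literature/AlgebraicGeometry/Motives`, lane `lit-hodgefound` (Track 2 foundations library — Layer A3 «Mumford–Tate
group»; prover seat `lit-hodgefound-p26`, gen 54, row g54-#7). Sequel of g54-#5 `…MumfordTateMorphisms` (the MUMFORD–TATE
versions: `centralizerIdeal_fromBlocks_le_mumfordTateIdeal_prod : MT(H ⊕ H′) ⊂ C(E_σ)`, `E_σ = fromBlocks 0 0 [σ] 0` the matrix
of `(v, v′) ↦ (0, σ v)`; `pointMatrix_mul_toMatrix_eq_of_comp_blockDiag_mem`; `exists_hom_iff_forall_pointMatrix_mul`), g51-#5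
`…MumfordTateCommutant` (`centralizerIdeal_le_mumfordTateIdeal_iff : MT(H) ⊂ C(f) ⟺ f ∈ End_HS`,
`centralizerIdeal_le_hodgeGroupIdeal_iff_le_mumfordTateIdeal : Hg(H) ⊂ C(F) ⟺ MT(H) ⊂ C(F)`), g50-#3 (`prodHodgeGroupIdeal`,
`hodgeCircleHomRat_prod`, `productMap_comp_blockDiag_mem_hodgeGroupPoints_iff`), g51-#7 (`extMumfordTateIdeal`,
`map_inl_mumfordTateIdeal_le_extMumfordTateIdeal`, `fst_mem_mumfordTatePoints_of_productMap_mem`) and g47-#11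
(`GLn.centralizerIdeal`, `centralizerIdeal_le_ker_iff`, `isHopfIdeal_centralizerIdeal`). THEOREMS only (no definition, no
named fact — net debt `0`), no `instance`, no notation, no sorry.

## The sources, verbatim

B. Moonen, *Notes on Mumford–Tate groups* (1999) [Moonen1999MTNotes] (held text `paper:url-c4d52097ebb3`, p0005 L12–L13,
L17–L18; p0007 L53–L54): "if `T` is of pure weight and `w ∈ T` then `w` is a `Hg(V)`-invariant if and only if it is a Hodge
`(p,p)`-class for some `p`."; "(1.13) The Hodge group of a product. Let `V₁` and `V₂` be ℚ-HS. Write `V := V₁ ⊕ V₂`. It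
readily follows from the definitions that `Hg(V) ⊆ Hg(V₁) × Hg(V₂)` and that the two projections `Hg(V) → Hg(V_i)` are
surjective."; (1.21) "`= MT(X)`-invariants in `End_ℚ(V)` `= Hg(X)`-invariants in `End_ℚ(V)`."; (p0005 L29–L31) "(1.14) […]
`M̃T(V)` can be described as the smallest algebraic ℚ-subgroup `M ⊂ GL(V) × 𝔾_{m,ℚ}` such that `h × Nm : 𝕊 → GL(V)_ℝ ×
𝔾_{m,ℝ}` factors through `M_ℝ`. The projection onto `GL(V)` gives a surjective homomorphism `M̃T(V) ↠ MT(V)`".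

B. Moonen (2004) [Moonen2004MT], §3 (p. 7): "Morphisms of ℚ-HS correspond to ℚ-linear maps `f : V → W` such that `f_ℝ` is
equivariant for the given actions of `𝕊`."; (4.5) "a morphism of HS `W₁ → W₂` is the same as a Hodge class in `Hom(W₁,
W₂)`."; M. Green, P. Griffiths, M. Kerr [GreenGriffithsKerr2012], §I.B (I.B.7) («`σ` does *not* induce a homomorphism of
Mumford-Tate groups»), (I.B.1) («`M_φ` is the subgroup of `GL(V)` fixing the Hodge tensors»); P. Deligne
[Deligne1982HodgeCycles], I §5 proof of Prop. 5.1 («elements commuting with the Hodge structure or, equivalently that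
commute with `μ(𝔾_m)`»); S. Montgomery [Montgomery1993Hopf], Def. 1.6.3; J. S. Milne [Milne2017], Remark 4.1, 2.h Prop.
2.46, Ch. 7 §c.

READING (recorded — RULING 29; no named fact). `Hom(V, V′)` for `V, V′` of the same weight `n` is pure of weight `0`, so by
MOONEN 1999 (the displayed line and (1.21)) its Hodge classes = morphisms `V → V′` (MOONEN (4.5)) are the `Hg(V ⊕
V′)`-invariants as well as the `MT(V ⊕ V′)`-invariants. In the tree's matrix language (§0 **`GLn.centralizerIdeal_fromBlocks_le_ker_comp_blockDiag_iff`**: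
a block-diagonal point `diag(x, x′)` kills the centralizer ideal of `E_σ = fromBlocks 0 0 [σ] 0` iff `[x′]·[σ] = [σ]·[x]`)
this is §1 **`centralizerIdeal_fromBlocks_le_mumfordTateIdeal_prod_iff : MT(H ⊕ H′) ⊂ C(E_σ) ⟺ σ ∈ Hom_HS(V, V′)`** (g54-#5
gave `⟸` and the point-wise converse) and §2 **`centralizerIdeal_fromBlocks_le_hodgeGroupIdeal_prod_iff : Hg(H ⊕ H′) ⊂ C(E_σ)
⟺ σ ∈ Hom_HS(V, V′)`** (through g51-#5's `Hg ⊂ C(F) ⟺ MT ⊂ C(F)`), with the point versions **`pointMatrix_mul_toMatrix_eq_of_comp_blockDiag_mem_hodgeGroupPoints`**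
(`diag(x, x′) ∈ Hg(H ⊕ H′)(T) ⟹ [x′]·[σ] = [σ]·[x]`; MOONEN (1.13): `Hg(V) ⊆ Hg(V₁) × Hg(V₂)`) and the converse
**`exists_hom_of_forall_hodgeGroupPoints_pointMatrix_mul`** through the single `O(𝕌_ℂ)`-valued point `(φ_H^*, φ_{H′}^*)` of
`Hg(H ⊕ H′)` and `le_genIdeal` (the centralizer ideal is a Hopf ideal killed by `φ_{H ⊕ H′}^*`, hence inside the largest
such, `I_{Hg(H ⊕ H′)}`). §3 MOONEN (1.14) «`M̃T(V) ↠ MT(V)`» transfers g47-#12's «`MT` commutes with `End_HS`» to the extended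
group: **`map_inl_centralizerIdeal_le_extMumfordTateIdeal : M̃T(H) ⊂ C(f) × 𝔾_m`**, on points **`pointMatrix_mul_toMatrix_eq_of_extMumfordTateIdeal_le_ker
: (x, y) ∈ M̃T(H)(T) ⟹ [x]·[f] = [f]·[x]`**, and conversely (the point `(h^*, Nm^*) ∈ M̃T(H)(O(𝕊_ℂ))`)
**`exists_hom_iff_forall_extMumfordTatePoints_pointMatrix_mul : f ∈ End_HS(V) ⟺ f` commutes with every `O(𝕊_ℂ)`-valued
point of `M̃T(H)`**. What is NOT here: the Hodge-group converse for UNEQUAL weights (false: MOONEN's line example), image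
sub-Hodge structures (GGK (I.B.7)).

## Contents

* §0 (namespace `…Tannakian.GLn`) **`centralizerIdeal_fromBlocks_le_ker_comp_blockDiag_iff`**.
* §1 (namespace `…Tannakian.DeligneTorus`) **`centralizerIdeal_fromBlocks_le_mumfordTateIdeal_prod_iff`**.
* §2 `centralizerIdeal_fromBlocks_le_hodgeGroupIdeal_prod`, **`centralizerIdeal_fromBlocks_le_hodgeGroupIdeal_prod_iff`**,
  `prodHodgeGroupIdeal_le_ker`, **`pointMatrix_mul_toMatrix_eq_of_comp_blockDiag_mem_hodgeGroupPoints`**,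
  `pointMatrix_mul_toMatrix_eq_of_prodHodgeGroupIdeal_le_ker`, `pointMatrix_hodgeCircleHomRat_mul_toMatrix`,
  `centralizerIdeal_fromBlocks_le_hodgeGroupIdeal_prod_of_pointMatrix_mul`, **`exists_hom_of_forall_hodgeGroupPoints_pointMatrix_mul`**,
  **`exists_hom_iff_forall_hodgeGroupPoints_pointMatrix_mul`**.
* §3 **`map_inl_centralizerIdeal_le_extMumfordTateIdeal`**, **`pointMatrix_mul_toMatrix_eq_of_extMumfordTateIdeal_le_ker`**,
  `pointMatrix_hodgeHomRat_mul_toMatrix_of_forall_extMumfordTatePoints`, **`exists_hom_of_forall_extMumfordTatePoints_pointMatrix_mul`**,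
  **`exists_hom_iff_forall_extMumfordTatePoints_pointMatrix_mul`**.

## References

* [Moonen1999MTNotes] B. Moonen, *Notes on Mumford–Tate groups*, CEB notes (1999): (1.13), (1.14), (1.21), p. 5.
* [Moonen2004MT] B. Moonen, *An introduction to Mumford–Tate groups* (2004): §3 (p. 7), Corollary 4.5, Lemma 4.6, (4.7).
* [GreenGriffithsKerr2012] M. Green, P. Griffiths, M. Kerr, *Mumford–Tate Groups and Domains* (2012): §I.B (I.B.1), (I.B.7), (ii).
* [Deligne1982HodgeCycles] P. Deligne, *Hodge cycles on abelian varieties*, LNM 900 (1982): I §5 proof of Prop. 5.1, I Prop. 3.4.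
* [Montgomery1993Hopf] S. Montgomery, *Hopf algebras and their actions on rings* (1993): Def. 1.6.3.
* [CarlsonMullerStachPeters2017] J. Carlson, S. Müller-Stach, C. Peters, *Period Mappings and Period Domains*, 2nd ed. (2017):
  §15.2 Def. 15.2.1 (ii), Remark (ii).
* [Milne2017] J. S. Milne, *Algebraic Groups*, CUP (2017): Remark 4.1, 2.h Prop. 2.46, Ch. 7 §c.
-/

noncomputable section

namespace Literature.AlgebraicGeometry.Motives.Tannakian

open TensorProduct WithConv Coalgebra

universe u u' v v' w

/-! ## §0 A block-diagonal point kills `𝔠(fromBlocks 0 0 F 0)` iff `[x′]·F = F·[x]` -/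

namespace GLn

variable {R : Type u} [CommRing R] {ι : Type v} {κ : Type v'} [Fintype ι] [DecidableEq ι] [Fintype κ] [DecidableEq κ]
  {B : Type w} [CommRing B] [Algebra R B]

/-- **`diag(x, x′) ∈ C(E)(B)` for `E = fromBlocks 0 0 F 0` iff `[x′]·F = F·[x]`** (`κ × ι` matrices over `B`): by block
multiplication `diag([x], [x′])·E = fromBlocks 0 0 ([x′]F) 0` and `E·diag([x], [x′]) = fromBlocks 0 0 (F[x]) 0`. [cite:
Milne2017, Ch. 7 §c («G_x(R) = {g ∈ G(R) | …}»), 2.8; Moonen2004MT, Lemma 4.6 («as subgroups of GL(V₁ ⊕ V₂)»)] -/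
theorem centralizerIdeal_fromBlocks_le_ker_comp_blockDiag_iff (F : Matrix κ ι R) (x : Coord R ι →ₐ[R] B)
    (x' : Coord R κ →ₐ[R] B) :
    centralizerIdeal (Matrix.fromBlocks 0 0 F 0) ≤
        RingHom.ker ((Algebra.TensorProduct.productMap x x').comp (blockDiag R ι κ)) ↔
      pointMatrix x' * F.map (algebraMap R B) = F.map (algebraMap R B) * pointMatrix x := by
  rw [centralizerIdeal_le_ker_iff, pointMatrix_productMap_comp_blockDiag, Matrix.fromBlocks_map, Matrix.fromBlocks_multiply,
    Matrix.fromBlocks_multiply]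
  simp only [Matrix.map_zero, map_zero, Matrix.mul_zero, Matrix.zero_mul, add_zero, zero_add]
  exact Matrix.fromBlocks_inj.trans ⟨fun h => h.2.2.1, fun h => ⟨rfl, rfl, h, rfl⟩⟩

end GLn

namespace DeligneTorus

open HodgeStructure

variable {V : Type u} [AddCommGroup V] [Module ℚ V] {W : Type u'} [AddCommGroup W] [Module ℚ W] {n : ℤ}
  {ι : Type v} [Fintype ι] [DecidableEq ι] {κ : Type v'} [Fintype κ] [DecidableEq κ]

/-! ## §1 `MT(H ⊕ H′) ⊂ C(E_σ) ⟺ σ` is a morphism of Hodge structures -/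

/-- **MOONEN (4.5) ∕ §3 in the Mumford–Tate group of the sum: `MT(H ⊕ H′) ⊂ C(fromBlocks 0 0 [σ] 0)` iff `σ` underlies a
morphism of Hodge structures `H → H′`** (`⟸` is g54-#5 `centralizerIdeal_fromBlocks_le_mumfordTateIdeal_prod`; `⟹`: the
`O(𝕊_ℂ)`-valued points `diag(x, x′)` of `MT(H ⊕ H′)` then satisfy `[x′]·[σ] = [σ]·[x]` (§0), and g54-#5
`exists_hom_of_forall_pointMatrix_mul` concludes). [cite: Moonen2004MT, Corollary 4.5 («a morphism of HS W₁ → W₂ is the same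
as a Hodge class in Hom(W₁, W₂)»), §3, Lemma 4.6; GreenGriffithsKerr2012, §I.B (I.B.7); Deligne1982HodgeCycles, I §5 proof
of Prop. 5.1] -/
theorem centralizerIdeal_fromBlocks_le_mumfordTateIdeal_prod_iff (H : HodgeStructure V n) (H' : HodgeStructure W n)
    (b : Module.Basis ι ℚ V) (b' : Module.Basis κ ℚ W) (σ : V →ₗ[ℚ] W) :
    GLn.centralizerIdeal (Matrix.fromBlocks 0 0 (LinearMap.toMatrix b b' σ) 0) ≤ mumfordTateIdeal (H.prod H') (b.prod b') ↔
      ∃ f : HodgeStructure.Hom H H', f.toLinearMap = σ := by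
  refine ⟨fun h => exists_hom_of_forall_pointMatrix_mul H H' b b' σ fun x x' hxx' => ?_, fun ⟨f, hf⟩ => ?_⟩
  · letI := GLn.bialgebra ℚ (ι ⊕ κ)
    have hmem := (productMap_comp_blockDiag_mem_mumfordTatePoints_iff H H' b b' x x').2 hxx'
    exact (GLn.centralizerIdeal_fromBlocks_le_ker_comp_blockDiag_iff _ x x').1 (le_trans h hmem)
  · rw [← hf]
    exact centralizerIdeal_fromBlocks_le_mumfordTateIdeal_prod H H' b b' f

/-! ## §2 MOONEN 1999 (1.13) ∕ (1.21): the Hodge group of `H ⊕ H′` and morphisms `H → H′` -/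

/-- **`Hg(H ⊕ H′) ⊂ C(fromBlocks 0 0 [σ] 0)` for a morphism `σ : H → H′`** (`MT ⊂ C` and `I_MT ⊂ I_Hg`). [cite: Moonen1999MTNotes,
(1.13), (1.21) («= Hg(X)-invariants in End_ℚ(V)»); GreenGriffithsKerr2012, §I.B (ii), (I.B.7)] -/
theorem centralizerIdeal_fromBlocks_le_hodgeGroupIdeal_prod (H : HodgeStructure V n) (H' : HodgeStructure W n)
    (b : Module.Basis ι ℚ V) (b' : Module.Basis κ ℚ W) (σ : HodgeStructure.Hom H H') :
    GLn.centralizerIdeal (Matrix.fromBlocks 0 0 (LinearMap.toMatrix b b' σ.toLinearMap) 0) ≤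
      hodgeGroupIdeal (H.prod H') (b.prod b') :=
  le_trans (centralizerIdeal_fromBlocks_le_mumfordTateIdeal_prod H H' b b' σ) (mumfordTateIdeal_le_hodgeGroupIdeal _ _)

/-- **MOONEN 1999: «`w` is a `Hg(V)`-invariant iff it is a Hodge `(p,p)`-class» for `w = σ ∈ Hom(V, V′)` (pure of weight
`0`): `Hg(H ⊕ H′) ⊂ C(fromBlocks 0 0 [σ] 0)` iff `σ` underlies a morphism of Hodge structures** (g51-#5 `Hg ⊂ C(F) ⟺ MT ⊂
C(F)` + §1). [cite: Moonen1999MTNotes, p. 5 («w is a Hg(V)-invariant if and only if it is a Hodge (p,p)-class»), (1.21);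
Moonen2004MT, Corollary 4.5; CarlsonMullerStachPeters2017, §15.2 Remark (ii)] -/
theorem centralizerIdeal_fromBlocks_le_hodgeGroupIdeal_prod_iff (H : HodgeStructure V n) (H' : HodgeStructure W n)
    (b : Module.Basis ι ℚ V) (b' : Module.Basis κ ℚ W) (σ : V →ₗ[ℚ] W) :
    GLn.centralizerIdeal (Matrix.fromBlocks 0 0 (LinearMap.toMatrix b b' σ) 0) ≤ hodgeGroupIdeal (H.prod H') (b.prod b') ↔
      ∃ f : HodgeStructure.Hom H H', f.toLinearMap = σ := by
  rw [centralizerIdeal_le_hodgeGroupIdeal_iff_le_mumfordTateIdeal, centralizerIdeal_fromBlocks_le_mumfordTateIdeal_prod_iff]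

/-- The pair `(φ_H^*, φ_{H′}^*)` of `O(𝕌_ℂ)`-valued points kills `prodHodgeGroupIdeal H H′ b b′` — `(φ_H, φ_{H′}) ∈ Hg(H ⊕
H′)(O(𝕌_ℂ))`. [cite: Moonen1999MTNotes, (1.13); Milne2017, 2.h Prop. 2.46] -/
theorem prodHodgeGroupIdeal_le_ker (H : HodgeStructure V n) (H' : HodgeStructure W n) (b : Module.Basis ι ℚ V)
    (b' : Module.Basis κ ℚ W) :
    prodHodgeGroupIdeal H H' b b' ≤
      RingHom.ker (Algebra.TensorProduct.productMap (hodgeCircleHomRat H b) (hodgeCircleHomRat H' b')) := by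
  letI := GLn.hopfAlgebra ℚ ι
  letI := GLn.hopfAlgebra ℚ κ
  rw [prodHodgeGroupIdeal_eq_genIdeal]
  exact genIdeal_le_ker _ ()

variable {T : Type w} [CommRing T] [Algebra ℚ T]

/-- **MORPHISMS INTERTWINE THE HODGE GROUP OF THE SUM: if `diag(x, x′) ∈ Hg(H ⊕ H′)(T)` then `[x′]·[σ] = [σ]·[x]`** for every
morphism `σ : H → H′` (MOONEN (1.13): `Hg(V) ⊆ Hg(V₁) × Hg(V₂)`, the points being block-diagonal). [cite: Moonen1999MTNotes,
(1.13), (1.21); GreenGriffithsKerr2012, §I.B (ii), (I.B.7); Milne2017, Ch. 7 §c] -/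
theorem pointMatrix_mul_toMatrix_eq_of_comp_blockDiag_mem_hodgeGroupPoints (H : HodgeStructure V n)
    (H' : HodgeStructure W n) (b : Module.Basis ι ℚ V) (b' : Module.Basis κ ℚ W) (σ : HodgeStructure.Hom H H')
    {x : GLn.Coord ℚ ι →ₐ[ℚ] T} {x' : GLn.Coord ℚ κ →ₐ[ℚ] T}
    (h : letI := GLn.bialgebra ℚ (ι ⊕ κ)
      toConv ((Algebra.TensorProduct.productMap x x').comp (GLn.blockDiag ℚ ι κ)) ∈
        hodgeGroupPoints (H.prod H') (b.prod b') T) :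
    GLn.pointMatrix x' * (LinearMap.toMatrix b b' σ.toLinearMap).map (algebraMap ℚ T) =
      (LinearMap.toMatrix b b' σ.toLinearMap).map (algebraMap ℚ T) * GLn.pointMatrix x :=
  (GLn.centralizerIdeal_fromBlocks_le_ker_comp_blockDiag_iff _ x x').1
    (le_trans (centralizerIdeal_fromBlocks_le_hodgeGroupIdeal_prod H H' b b' σ) h)

/-- **The same for any pair `(x, x′)` killing `prodHodgeGroupIdeal H H′ b b′`** (`(x, x′) ∈ Hg(H ⊕ H′)(T) ⊂ GL_ι(T) × GL_κ(T)`).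
[cite: Moonen1999MTNotes, (1.13); GreenGriffithsKerr2012, §I.B (I.B.7)] -/
theorem pointMatrix_mul_toMatrix_eq_of_prodHodgeGroupIdeal_le_ker (H : HodgeStructure V n) (H' : HodgeStructure W n)
    (b : Module.Basis ι ℚ V) (b' : Module.Basis κ ℚ W) (σ : HodgeStructure.Hom H H') {x : GLn.Coord ℚ ι →ₐ[ℚ] T}
    {x' : GLn.Coord ℚ κ →ₐ[ℚ] T} (h : prodHodgeGroupIdeal H H' b b' ≤ RingHom.ker (Algebra.TensorProduct.productMap x x')) :
    GLn.pointMatrix x' * (LinearMap.toMatrix b b' σ.toLinearMap).map (algebraMap ℚ T) =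
      (LinearMap.toMatrix b b' σ.toLinearMap).map (algebraMap ℚ T) * GLn.pointMatrix x :=
  pointMatrix_mul_toMatrix_eq_of_comp_blockDiag_mem_hodgeGroupPoints H H' b b' σ
    ((productMap_comp_blockDiag_mem_hodgeGroupPoints_iff H H' b b' x x').2 h)

/-- In particular `[φ_{H′}^*]·[σ] = [σ]·[φ_H^*]` over `O(𝕌_ℂ)` (`σ_ℂ` is `𝕌_ℂ`-equivariant). [cite: Moonen2004MT, §3;
CarlsonMullerStachPeters2017, §15.2 Def. 15.2.1 (ii) («h|U»); Montgomery1993Hopf, Def. 1.6.3] -/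
theorem pointMatrix_hodgeCircleHomRat_mul_toMatrix (H : HodgeStructure V n) (H' : HodgeStructure W n)
    (b : Module.Basis ι ℚ V) (b' : Module.Basis κ ℚ W) (σ : HodgeStructure.Hom H H') :
    GLn.pointMatrix (hodgeCircleHomRat H' b') * (LinearMap.toMatrix b b' σ.toLinearMap).map (algebraMap ℚ (CircleCoord ℂ)) =
      (LinearMap.toMatrix b b' σ.toLinearMap).map (algebraMap ℚ (CircleCoord ℂ)) * GLn.pointMatrix (hodgeCircleHomRat H b) :=
  pointMatrix_mul_toMatrix_eq_of_prodHodgeGroupIdeal_le_ker H H' b b' σ (prodHodgeGroupIdeal_le_ker H H' b b')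

/-- **If `[φ_{H′}^*]·[σ] = [σ]·[φ_H^*]` then `Hg(H ⊕ H′) ⊂ C(fromBlocks 0 0 [σ] 0)`**: the centralizer ideal is a Hopf ideal
(g47-#11) killed by `φ_{H ⊕ H′}^* = (φ_H^*, φ_{H′}^*) ∘ diag` (§0 with g50-#3 `hodgeCircleHomRat_prod`), hence lies in the
largest such, `I_{Hg(H ⊕ H′)}` (`le_genIdeal`). [cite: Moonen1999MTNotes, (1.13); Milne2017, 2.h Prop. 2.46;
CarlsonMullerStachPeters2017, §15.2 Def. 15.2.1 (ii) («the smallest ℚ-algebraic subgroup … over which h|U factors»)] -/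
theorem centralizerIdeal_fromBlocks_le_hodgeGroupIdeal_prod_of_pointMatrix_mul (H : HodgeStructure V n)
    (H' : HodgeStructure W n) (b : Module.Basis ι ℚ V) (b' : Module.Basis κ ℚ W) (σ : V →ₗ[ℚ] W)
    (h : GLn.pointMatrix (hodgeCircleHomRat H' b') * (LinearMap.toMatrix b b' σ).map (algebraMap ℚ (CircleCoord ℂ)) =
      (LinearMap.toMatrix b b' σ).map (algebraMap ℚ (CircleCoord ℂ)) * GLn.pointMatrix (hodgeCircleHomRat H b)) :
    GLn.centralizerIdeal (Matrix.fromBlocks 0 0 (LinearMap.toMatrix b b' σ) 0) ≤ hodgeGroupIdeal (H.prod H') (b.prod b') := by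
  letI := GLn.hopfAlgebra ℚ (ι ⊕ κ)
  have h1 : GLn.centralizerIdeal (Matrix.fromBlocks 0 0 (LinearMap.toMatrix b b' σ) 0) ≤
      RingHom.ker (hodgeCircleHomRat (H.prod H') (b.prod b')) := by
    rw [hodgeCircleHomRat_prod]
    exact (GLn.centralizerIdeal_fromBlocks_le_ker_comp_blockDiag_iff _ _ _).2 h
  rw [hodgeGroupIdeal_eq_genIdeal]
  exact le_genIdeal (GLn.isHopfIdeal_centralizerIdeal _) fun _ => h1

/-- **MOONEN 1999 (1.21) for `Hom(V, V′)`, converse on points: a `ℚ`-linear `σ` with `[x′]·[σ] = [σ]·[x]` for every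
`O(𝕌_ℂ)`-valued point `(x, x′)` of `Hg(H ⊕ H′)` underlies a morphism of Hodge structures `H → H′`** — the single point
`(φ_H^*, φ_{H′}^*)` suffices. [cite: Moonen1999MTNotes, p. 5, (1.21) («= Hg(X)-invariants in End_ℚ(V)»); Moonen2004MT,
Corollary 4.5, §3; GreenGriffithsKerr2012, §I.B (I.B.1)] -/
theorem exists_hom_of_forall_hodgeGroupPoints_pointMatrix_mul (H : HodgeStructure V n) (H' : HodgeStructure W n)
    (b : Module.Basis ι ℚ V) (b' : Module.Basis κ ℚ W) (σ : V →ₗ[ℚ] W)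
    (h : ∀ (x : GLn.Coord ℚ ι →ₐ[ℚ] CircleCoord ℂ) (x' : GLn.Coord ℚ κ →ₐ[ℚ] CircleCoord ℂ),
      prodHodgeGroupIdeal H H' b b' ≤ RingHom.ker (Algebra.TensorProduct.productMap x x') →
        GLn.pointMatrix x' * (LinearMap.toMatrix b b' σ).map (algebraMap ℚ (CircleCoord ℂ)) =
          (LinearMap.toMatrix b b' σ).map (algebraMap ℚ (CircleCoord ℂ)) * GLn.pointMatrix x) :
    ∃ f : HodgeStructure.Hom H H', f.toLinearMap = σ :=
  (centralizerIdeal_fromBlocks_le_hodgeGroupIdeal_prod_iff H H' b b' σ).1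
    (centralizerIdeal_fromBlocks_le_hodgeGroupIdeal_prod_of_pointMatrix_mul H H' b b' σ
      (h _ _ (prodHodgeGroupIdeal_le_ker H H' b b')))

/-- **`σ` underlies a morphism `H → H′` iff it intertwines every `O(𝕌_ℂ)`-valued point of `Hg(H ⊕ H′)`** (equal weights).
[cite: Moonen1999MTNotes, p. 5, (1.13), (1.21); Moonen2004MT, Corollary 4.5; GreenGriffithsKerr2012, §I.B (I.B.7)] -/
theorem exists_hom_iff_forall_hodgeGroupPoints_pointMatrix_mul (H : HodgeStructure V n) (H' : HodgeStructure W n)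
    (b : Module.Basis ι ℚ V) (b' : Module.Basis κ ℚ W) (σ : V →ₗ[ℚ] W) :
    (∃ f : HodgeStructure.Hom H H', f.toLinearMap = σ) ↔
      ∀ (x : GLn.Coord ℚ ι →ₐ[ℚ] CircleCoord ℂ) (x' : GLn.Coord ℚ κ →ₐ[ℚ] CircleCoord ℂ),
        prodHodgeGroupIdeal H H' b b' ≤ RingHom.ker (Algebra.TensorProduct.productMap x x') →
          GLn.pointMatrix x' * (LinearMap.toMatrix b b' σ).map (algebraMap ℚ (CircleCoord ℂ)) =
            (LinearMap.toMatrix b b' σ).map (algebraMap ℚ (CircleCoord ℂ)) * GLn.pointMatrix x := by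
  refine ⟨fun ⟨f, hf⟩ x x' hxx' => ?_, exists_hom_of_forall_hodgeGroupPoints_pointMatrix_mul H H' b b' σ⟩
  rw [← hf]
  exact pointMatrix_mul_toMatrix_eq_of_prodHodgeGroupIdeal_le_ker H H' b b' f hxx'

/-! ## §3 MOONEN (1.14): the extended Mumford–Tate group commutes with `End_HS(V)` — `M̃T(H) ⊂ C(f) × 𝔾_m` -/

/-- **`M̃T(H) ⊂ C(f) × 𝔾_m` for every endomorphism `f` of the Hodge structure**: the centralizer ideal of `[f]_b`, pushed
into `O(GL_ι) ⊗ ℚ[T,T⁻¹]`, lies in the extended Mumford–Tate ideal (g47-#12 `MT(H) ⊂ C(f)` and g51-#7 `pr₁(M̃T(H)) ⊂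
MT(H)`). [cite: Moonen1999MTNotes, (1.14) («the projection onto GL(V) gives a surjective homomorphism M̃T(V) ↠ MT(V)»);
Deligne1982HodgeCycles, I §5 proof of Prop. 5.1; Moonen2004MT, (4.7)] -/
theorem map_inl_centralizerIdeal_le_extMumfordTateIdeal (H : HodgeStructure V n) (b : Module.Basis ι ℚ V)
    (f : HodgeStructure.Hom H H) :
    letI := GLn.bialgebra ℚ ι
    (GLn.centralizerIdeal (LinearMap.toMatrix b b f.toLinearMap)).map
        (inlBialgHom ℚ (GLn.Coord ℚ ι) (LaurentPolynomial ℚ)) ≤ extMumfordTateIdeal H b :=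
  le_trans (Ideal.map_mono (centralizerIdeal_le_mumfordTateIdeal H b f)) (map_inl_mumfordTateIdeal_le_extMumfordTateIdeal H b)

/-- **EVERY `T`-POINT `(x, y)` OF `M̃T(H) ⊂ GL_ι × 𝔾_m` COMMUTES WITH EVERY ENDOMORPHISM OF THE HODGE STRUCTURE: `[x]·[f] =
[f]·[x]`** (`x ∈ MT(H)(T)` by g51-#7, then g47-#12). [cite: Moonen1999MTNotes, (1.14); Deligne1982HodgeCycles, I §5 proof of
Prop. 5.1 («elements commuting with the Hodge structure»); Milne2017, Ch. 7 §c] -/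
theorem pointMatrix_mul_toMatrix_eq_of_extMumfordTateIdeal_le_ker (H : HodgeStructure V n) (b : Module.Basis ι ℚ V)
    (f : HodgeStructure.Hom H H) {x : GLn.Coord ℚ ι →ₐ[ℚ] T} {y : LaurentPolynomial ℚ →ₐ[ℚ] T}
    (h : extMumfordTateIdeal H b ≤ RingHom.ker (Algebra.TensorProduct.productMap x y)) :
    GLn.pointMatrix x * (LinearMap.toMatrix b b f.toLinearMap).map (algebraMap ℚ T) =
      (LinearMap.toMatrix b b f.toLinearMap).map (algebraMap ℚ T) * GLn.pointMatrix x :=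
  pointMatrix_mul_toMatrix_eq_of_mem_mumfordTatePoints H b f (fst_mem_mumfordTatePoints_of_productMap_mem H b h)

/-- If `[x]·[f] = [f]·[x]` for every `O(𝕊_ℂ)`-valued point `(x, y)` of `M̃T(H)`, then in particular for `(h^*, Nm^*)` (which
kills `I_{M̃T}`, g51-#7 `extMumfordTateIdeal_le_ker`): `[h^*]·[f] = [f]·[h^*]`. [cite: Moonen1999MTNotes, (1.14) («h × Nm … factors
through M_ℝ»); Moonen2004MT, §3] -/
theorem pointMatrix_hodgeHomRat_mul_toMatrix_of_forall_extMumfordTatePoints (H : HodgeStructure V n)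
    (b : Module.Basis ι ℚ V) (f : V →ₗ[ℚ] V)
    (h : ∀ (x : GLn.Coord ℚ ι →ₐ[ℚ] Coord ℂ) (y : LaurentPolynomial ℚ →ₐ[ℚ] Coord ℂ),
      extMumfordTateIdeal H b ≤ RingHom.ker (Algebra.TensorProduct.productMap x y) →
        GLn.pointMatrix x * (LinearMap.toMatrix b b f).map (algebraMap ℚ (Coord ℂ)) =
          (LinearMap.toMatrix b b f).map (algebraMap ℚ (Coord ℂ)) * GLn.pointMatrix x) :
    GLn.pointMatrix (hodgeHomRat H b) * (LinearMap.toMatrix b b f).map (algebraMap ℚ (Coord ℂ)) =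
      (LinearMap.toMatrix b b f).map (algebraMap ℚ (Coord ℂ)) * GLn.pointMatrix (hodgeHomRat H b) :=
  h (hodgeHomRat H b) normHomRat (extMumfordTateIdeal_le_ker H b)

/-- **Conversely, a `ℚ`-linear `f` commuting with every `O(𝕊_ℂ)`-valued point of `M̃T(H)` is an endomorphism of the Hodge
structure** (g54-#5 `map_F_le_iff_pointMatrix_hodgeHomRat_mul` at the point `(h^*, Nm^*)`). [cite: Moonen2004MT, §3 («f_ℝ …
equivariant for the given actions of 𝕊»), Corollary 4.5; Moonen1999MTNotes, (1.14), (1.21); Deligne1982HodgeCycles, I §5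
proof of Prop. 5.1] -/
theorem exists_hom_of_forall_extMumfordTatePoints_pointMatrix_mul (H : HodgeStructure V n) (b : Module.Basis ι ℚ V)
    (f : V →ₗ[ℚ] V)
    (h : ∀ (x : GLn.Coord ℚ ι →ₐ[ℚ] Coord ℂ) (y : LaurentPolynomial ℚ →ₐ[ℚ] Coord ℂ),
      extMumfordTateIdeal H b ≤ RingHom.ker (Algebra.TensorProduct.productMap x y) →
        GLn.pointMatrix x * (LinearMap.toMatrix b b f).map (algebraMap ℚ (Coord ℂ)) =
          (LinearMap.toMatrix b b f).map (algebraMap ℚ (Coord ℂ)) * GLn.pointMatrix x) :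
    ∃ φ : HodgeStructure.Hom H H, φ.toLinearMap = f :=
  ⟨⟨f, (map_F_le_iff_pointMatrix_hodgeHomRat_mul H H b b f).2
    (pointMatrix_hodgeHomRat_mul_toMatrix_of_forall_extMumfordTatePoints H b f h)⟩, rfl⟩

/-- **`End_HS(V) = End_ℚ(V)^{M̃T(H)}` on `O(𝕊_ℂ)`-valued points: `f ∈ End_HS(V)` iff `[x]·[f] = [f]·[x]` for every
`O(𝕊_ℂ)`-valued point `(x, y)` of `M̃T(H)`.** [cite: Moonen1999MTNotes, (1.14), (1.21) («= MT(X)-invariants in End_ℚ(V)»);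
Moonen2004MT, Corollary 4.5, (4.7); Deligne1982HodgeCycles, I §5 proof of Prop. 5.1] -/
theorem exists_hom_iff_forall_extMumfordTatePoints_pointMatrix_mul (H : HodgeStructure V n) (b : Module.Basis ι ℚ V)
    (f : V →ₗ[ℚ] V) :
    (∃ φ : HodgeStructure.Hom H H, φ.toLinearMap = f) ↔
      ∀ (x : GLn.Coord ℚ ι →ₐ[ℚ] Coord ℂ) (y : LaurentPolynomial ℚ →ₐ[ℚ] Coord ℂ),
        extMumfordTateIdeal H b ≤ RingHom.ker (Algebra.TensorProduct.productMap x y) →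
          GLn.pointMatrix x * (LinearMap.toMatrix b b f).map (algebraMap ℚ (Coord ℂ)) =
            (LinearMap.toMatrix b b f).map (algebraMap ℚ (Coord ℂ)) * GLn.pointMatrix x := by
  refine ⟨fun ⟨φ, hφ⟩ x y hxy => ?_, exists_hom_of_forall_extMumfordTatePoints_pointMatrix_mul H b f⟩
  rw [← hφ]
  exact pointMatrix_mul_toMatrix_eq_of_extMumfordTateIdeal_le_ker H b φ hxy

end DeligneTorus

end Literature.AlgebraicGeometry.Motives.Tannakian
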